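import Literature.Probability.RandomPlanarGeometry.SLEDriftedDriving
import HarnessLib

/-!
# No positive real point is swallowed by the chain driven by `√κ Bₜ + c t`, `κ ≤ 4`: proof

Topic `Probability/RandomPlanarGeometry`; theorems only (proof sibling of `SLEDriftedDriving`).
We discharge the named fact
`Literature.Probability.RandomPlanarGeometry.sle_drift_swallowingTime_ofReal_eq_top`
([LSW] Lawler–Schramm–Werner, *Conformal restriction: the chordal case* (2003), proof of
Lemma 8.3, arXiv p. 36: "for any finite fixed `t₀ > 0` and any `c ∈ ℝ` the law of the process
`(Bₜ + c t, t ≤ t₀)` is equicontinuous with the law of `(Bₜ, t ≤ t₀)` … Therefore, also in this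
case `x̃ₜ` never hits `0`"): for `0 < κ ≤ 4` and every real `c`, almost surely no real `x > 0`
is swallowed by the Loewner chain driven by `Wₜ = √κ Bₜ + c t`
(`sle_drift_swallowingTime_ofReal_eq_top_holds`).

[LSW] argue by mutual absolute continuity of the laws of `B` and `B + c·` on finite horizons
(Cameron–Martin), which the tree does not have. We prove the statement directly by Lawler's
optional-stopping argument for the case `c = 0` (Lawler (2005), Prop. 1.21 / Prop. 6.8 (i);
the tree's `ae_sle_swallowingTime_eq_top_of_le_four`, `SLEOnePointNonSwallowingProofs`), run for
the drifted flow. Seen from the driving point, the real flow `Xₜ = gₜ(x) - Wₜ` of the chain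
driven by `W = √κ B + c·` satisfies, before the swallowing time `T_x`,

  `dXₜ = (2/Xₜ - c) dt - √κ dBₜ`,   generator `L F = (2/u - c) F' + (κ/2) F''`.

Instead of the (non-elementary) scale function of `L` we use the elementary **Lyapunov function**

  `Φ(u) = log u + (κ/4) · exp((2c/κ) u)`,  `L Φ(u) = (2 - κ/2)/u² + (c/u)(e^{2cu/κ} - 1) ≥ 0`

for `κ ≤ 4` and *every* real `c` (`c` and `e^{2cu/κ} - 1` have the same sign), which is bounded
above on `(0, x₂]` and tends to `-∞` at `0+`. Steps (`0 < x₁ < x < x₂`, `σ` the exit time of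
`X` from `(x₁, x₂)`, `Y = X^σ`):

1. the stopped drifted flow `Y` is an Itô process `dY = 𝟙_{[0,σ]}((2/Y - c) dt - √κ dB)`
   (`isItoProcess_stoppedProcess_sleDriftRealFlowStop`; pathwise this is the Loewner equation
   for real points in integrated form, `Loewner.realFlowStop_eq_sub_add_integral`);
2. **generator inequality** (`le_integral_of_generator_nonneg`): for `F ∈ C²(ℝ)` with
   `L F ≥ 0` on `[x₁, x₂]`, `F(x) ≤ E[F(Y_t)]` — Itô's formula
   (`Literature.Analysis.FunctionSpaces.ito_formula_itoProcess_ae_of`) gives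
   `F(Y_t) = F(x) + ∫₀ᵗ 𝟙_{s ≤ σ} (L F)(Y_s) ds + K_t ≥ F(x) + K_t` with `K = ∫ σ F'(Y) dB` a
   true martingale (bounded progressive integrand), `K₀ = 0`;
3. Markov's inequality for `M - Φ(Y_t) ≥ 0` (`M` an upper bound of `Φ` on `(0, x₂]`):
   `P{Y_t = x₁} ≤ (M - Φ(x)) / (M - Φ(x₁)) → 0` as `x₁ → 0+`;
4. pathwise (`Loewner.realFlowStop_untopA_eq_of_swallowingTime_le`, any continuous driving
   function): on `{T_x ≤ t, level x₂ not reached by time t}` one has `Y_t = x₁`; every path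
   misses some integer level up to time `t`; hence `P{T_x ≤ t} = 0` for every `t`, `T_x = ∞`
   a.s. for each `x > 0`, and for all `x > 0` simultaneously by monotonicity of `T_x` in `x`
   (`Loewner.forall_swallowingTime_eq_top_of_seq`).

## Mathlib / Literature

We USE the tree's Loewner-flow API for a general continuous driving function (`LoewnerAdapted`,
`SLERealFlowIto`, `SLEOnePointSwallowingProofs`, `SLEOnePointNonSwallowingProofs`), the Itô stack
(`ItoProcessesProofs`, `ProgressiveDensity`, `ItoFormulaProofs`), `ContinuousHitting`
(exit times), and Mathlib's `stoppedProcess`, `IsStoppingTime`, `Martingale.setIntegral_eq`,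
`mul_meas_ge_le_integral_of_nonneg` (Markov), `ContDiffBump` (through
`exists_contDiff_eventuallyEq_of_pos`), `Real.tendsto_log_nhdsGT_zero`, `Real.add_one_le_exp`.

## References

* G. F. Lawler, O. Schramm, W. Werner, *Conformal restriction: the chordal case*, J. Amer. Math.
  Soc. 16 (2003), 917–955, §8.3, proof of Lemma 8.3 (arXiv math/0209343, p. 36).
* G. F. Lawler, *Conformally Invariant Processes in the Plane*, AMS (2005), §1.10 Prop. 1.21
  (optional stopping for the Bessel flow), §6.2 Prop. 6.8.
* D. Revuz, M. Yor, *Continuous Martingales and Brownian Motion* (3rd ed., 1999), Ch. IV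
  (Itô's formula), Ch. VIII §1 (Cameron–Martin, the route of [LSW]).
-/

noncomputable section

open MeasureTheory ProbabilityTheory Filter Set Complex Topology
open scoped NNReal ENNReal

namespace Literature.Probability.RandomPlanarGeometry

/-! ### Local notations -/

/-- Local notation `𝖶[κ, c] ω` for the **drifted SLE driving function** `t ↦ √κ B_t(ω) + c t`
(the comparison process of [LSW] proof of Lemma 8.3), literally the driving function of the named
fact. -/
local notation3 "𝖶[" κ ", " c "] " ω:max => fun (t : ℝ≥0) ↦ sleDriving κ ω t + c * (t : ℝ)

/-- Local notation `𝖷[κ, c, x]` for the **frozen real flow of the drifted chain** as a process on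
the canonical space: `(t, ω) ↦ re gₜ(x) - (√κ B_t + c t)` before the swallowing time of `x`, `0`
after (`Loewner.realFlowStop` of the driving function `𝖶[κ, c] ω`). -/
local notation3 "𝖷[" κ ", " c ", " x "]" =>
  fun (t : ℝ≥0) (ω : ℝ≥0 → ℝ) ↦ Loewner.realFlowStop (fun (s : ℝ≥0) ↦ sleDriving κ ω s + c * (s : ℝ)) x t

/-- Local notation `Φ⟪κ, c⟫ u = log u + (κ/4) · exp((2c/κ) u)`: the **Lyapunov function** of the
generator `L = (2/u - c) d/du + (κ/2) d²/du²` of the drifted flow — `L Φ ≥ 0` on `(0, ∞)` for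
`κ ≤ 4` (`generator_driftLyapunov_nonneg`), bounded above on bounded intervals, `Φ(0+) = -∞`.
(For `c = 0` it is Lawler's `log u`, the scale function at `κ = 4`, up to a constant.) -/
local notation3 "Φ⟪" κ ", " c "⟫ " u:max => Real.log u + κ / 4 * Real.exp (2 * c / κ * u)

/-- Local notation `𝔅⟪κ, c⟫ x₂ = log x₂ + (κ/4) e^{|2c/κ| x₂}`, an upper bound of `Φ⟪κ, c⟫` on
`(0, x₂]`. -/
local notation3 "𝔅⟪" κ ", " c "⟫ " y:max => Real.log y + κ / 4 * Real.exp (|2 * c / κ| * y)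

/-! ### The drifted driving function `√κ B + c·` and its frozen real flow -/

section Drifted

open Loewner Literature.Probability.Process Literature.Analysis.FunctionSpaces

variable (κ : ℝ≥0) (c : ℝ)

/-- The drifted driving function starts at `0`. [folklore] -/
theorem sleDriving_add_mul_zero (ω : ℝ≥0 → ℝ) : sleDriving κ ω 0 + c * ((0 : ℝ≥0) : ℝ) = 0 := by
  simp

/-- The drifted driving function has continuous paths. [folklore] -/
theorem continuous_sleDriftDriving (ω : ℝ≥0 → ℝ) : Continuous (𝖶[κ, c] ω) :=
  (continuous_sleDriving κ ω).add (continuous_const.mul NNReal.continuous_coe)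

/-- `√κ B_s + c s` is `𝓕ᵂ_t`-measurable for `s ≤ t`. [folklore] -/
theorem measurable_sleDriftDriving_of_le {s t : ℝ≥0} (hs : s ≤ t) :
    Measurable[brownianFiltration t] fun ω ↦ sleDriving κ ω s + c * (s : ℝ) :=
  (measurable_sleDriving_of_le κ hs).add_const _

variable {κ c} {x : ℝ}

/-- The frozen drifted flow from `x ≠ 0` has continuous paths. [folklore] -/
theorem continuous_sleDriftRealFlowStop (hx : x ≠ 0) (ω : ℝ≥0 → ℝ) :
    Continuous fun t ↦ realFlowStop (𝖶[κ, c] ω) x t :=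
  continuous_realFlowStop_of_ne (continuous_sleDriftDriving κ c ω) (by simpa using hx)

/-- The frozen drifted flow starts at `x`. [folklore] -/
theorem sleDriftRealFlowStop_zero_apply (hx : x ≠ 0) (ω : ℝ≥0 → ℝ) :
    realFlowStop (𝖶[κ, c] ω) x 0 = x := by
  rw [realFlowStop_zero_of_ne (continuous_sleDriftDriving κ c ω) (by simpa using hx)]
  simp

/-- **The frozen drifted flow is adapted** to the raw Brownian filtration (`x > 0`): the real
flow is a measurable functional of the driving path up to time `t`
(`Loewner.measurable_realFlowTrunc`). [cite: Lawler2005, Ch. 4 §4.1] -/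
theorem adapted_sleDriftRealFlowStop (κ : ℝ≥0) (c : ℝ) (hx : 0 < x) :
    Adapted brownianFiltration 𝖷[κ, c, x] := fun t ↦
  measurable_realFlowTrunc (mΩ := brownianFiltration t) (W := fun ω ↦ 𝖶[κ, c] ω)
    (t := t) (fun ω ↦ continuous_sleDriftDriving κ c ω) (fun ω ↦ sleDriving_add_mul_zero κ c ω)
    (fun _ hs ↦ measurable_sleDriftDriving_of_le κ c hs) hx

/-- The frozen drifted flow is strongly adapted (`x > 0`). [folklore] -/
theorem stronglyAdapted_sleDriftRealFlowStop (κ : ℝ≥0) (c : ℝ) (hx : 0 < x) :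
    StronglyAdapted brownianFiltration 𝖷[κ, c, x] := fun t ↦
  (adapted_sleDriftRealFlowStop κ c hx t).stronglyMeasurable

/-- The frozen drifted flow is progressively measurable (continuous and adapted). [folklore] -/
theorem isStronglyProgressive_sleDriftRealFlowStop (κ : ℝ≥0) (c : ℝ) (hx : 0 < x) :
    IsStronglyProgressive brownianFiltration 𝖷[κ, c, x] :=
  (stronglyAdapted_sleDriftRealFlowStop κ c hx).isStronglyProgressive_of_continuous
    fun ω ↦ continuous_sleDriftRealFlowStop hx.ne' ω

/-! ### The stopped drifted flow is an Itô process: `dX = (2/X - c) dt - √κ dB` -/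

/-- **Pathwise integrated form of the stopped drifted flow.** Let `x ≠ 0`, `ρ` a random time,
and suppose the drifted flow `X = 𝖷[κ, c, x]` does not vanish on `[0, ρ]`. Then for every `ω` and
`t`, with `V = X^ρ`, `V_t = x + ∫₀ᵗ 𝟙_{s ≤ ρ} (2/V_s - c) ds - √κ B_{t ∧ ρ}`: the Loewner
equation for real points in integrated form (`Loewner.realFlowStop_eq_sub_add_integral`) for
the driving function `√κ B + c·`. [cite: LawlerSchrammWerner2003Restriction, proof of Lemma 8.3 (p. 36)] -/
theorem stoppedProcess_sleDriftRealFlowStop_eq (hx : x ≠ 0) {ρ : (ℝ≥0 → ℝ) → WithTop ℝ≥0}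
    (hρX : ∀ ω (t : ℝ≥0), (t : WithTop ℝ≥0) ≤ ρ ω → realFlowStop (𝖶[κ, c] ω) x t ≠ 0)
    (ω : ℝ≥0 → ℝ) (t : ℝ≥0) :
    stoppedProcess 𝖷[κ, c, x] ρ t ω =
      x + (∫ s in (0 : ℝ)..t, trunc ρ
        (fun s ω ↦ 2 / stoppedProcess 𝖷[κ, c, x] ρ s ω - c) s.toNNReal ω) +
      -Real.sqrt κ * brownian ((min (t : WithTop ℝ≥0) (ρ ω)).untopA) ω := by
  set u : ℝ≥0 := (min (t : WithTop ℝ≥0) (ρ ω)).untopA with hu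
  have huρ : (u : WithTop ℝ≥0) ≤ ρ ω := coe_untopA_min_le t (ρ ω)
  have hW := continuous_sleDriftDriving κ c ω
  have hx' : x ≠ sleDriving κ ω 0 + c * ((0 : ℝ≥0) : ℝ) := by simpa using hx
  have hXu : realFlowStop (𝖶[κ, c] ω) x u ≠ 0 := hρX ω u huρ
  have huT : (u : WithTop ℝ≥0) < swallowingTime (𝖶[κ, c] ω) x :=
    coe_lt_swallowingTime_of_realFlowStop_ne_zero hXu
  have hsρ : ∀ s ∈ Icc (0 : ℝ) u, ((s.toNNReal : ℝ≥0) : WithTop ℝ≥0) ≤ ρ ω := fun s hs ↦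
    (WithTop.coe_le_coe.2 (Real.toNNReal_le_iff_le_coe.2 hs.2)).trans huρ
  -- the drift `2/X` is continuous, hence integrable, on `[0, u]`
  have hii : IntervalIntegrable (fun s : ℝ ↦ 2 / realFlowStop (𝖶[κ, c] ω) x s.toNNReal)
      volume 0 u := by
    refine ContinuousOn.intervalIntegrable ?_
    rw [uIcc_of_le (NNReal.coe_nonneg _)]
    refine continuousOn_const.div
      ((continuous_realFlowStop_of_ne hW hx').comp continuous_real_toNNReal).continuousOn
      fun s hs ↦ ?_
    exact hρX ω _ (hsρ s hs)
  -- the time integral of the truncated drift is the integral up to `u`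
  have hint : (∫ s in (0 : ℝ)..t, trunc ρ
      (fun s ω ↦ 2 / stoppedProcess 𝖷[κ, c, x] ρ s ω - c) s.toNNReal ω) =
      (∫ s in (0 : ℝ)..u, 2 / realFlowStop (𝖶[κ, c] ω) x s.toNNReal) - c * u := by
    have h1 := timeIntegral_trunc
      (fun s ω ↦ 2 / stoppedProcess 𝖷[κ, c, x] ρ s ω - c) ρ t ω
    simp only [timeIntegral] at h1
    rw [h1]
    have h2 : (∫ s in (0 : ℝ)..u,
        (2 / stoppedProcess 𝖷[κ, c, x] ρ s.toNNReal ω - c)) =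
        ∫ s in (0 : ℝ)..u, (2 / realFlowStop (𝖶[κ, c] ω) x s.toNNReal - c) := by
      refine intervalIntegral.integral_congr fun s hs ↦ ?_
      rw [uIcc_of_le (NNReal.coe_nonneg _)] at hs
      simp only [stoppedProcess_eq_of_le (hsρ s hs)]
    rw [h2, intervalIntegral.integral_sub hii intervalIntegrable_const,
      intervalIntegral.integral_const, smul_eq_mul, sub_zero, mul_comm]
  have hstop : stoppedProcess 𝖷[κ, c, x] ρ t ω =
      realFlowStop (𝖶[κ, c] ω) x u := rfl
  rw [hint, hstop, realFlowStop_eq_sub_add_integral hW hx' huT]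
  simp only [sleDriving_apply]
  ring

/-- **The stopped frozen drifted flow is an Itô process.** Let `x ≠ 0`, `ρ` a stopping time of
the raw Brownian filtration before which `X = 𝖷[κ, c, x]` does not vanish. Then
`V = X^ρ` is an Itô process driven by the canonical Brownian motion with drift
`𝟙_{s ≤ ρ} (2/V_s - c)` and diffusion coefficient `𝟙_{s ≤ ρ}(-√κ)`: the SDE
`dX = (2/X - c) dt - √κ dB` of [LSW] p. 36 ("`dx̃ₜ = … - √κ dBₜ + (2/x̃ₜ) dt`" with the drift
`c dt` of the comparison driving function), localised before the swallowing time; the stochastic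
term is the Itô integral of the truncated constant, indistinguishable from `-√κ B^ρ`
(`IsItoIntegral.ae_eq_stoppedProcess`). [cite: LawlerSchrammWerner2003Restriction, proof of Lemma 8.3 (p. 36)] -/
theorem isItoProcess_stoppedProcess_sleDriftRealFlowStop (hx : x ≠ 0)
    {ρ : (ℝ≥0 → ℝ) → WithTop ℝ≥0} (hρ : IsStoppingTime brownianFiltration ρ)
    (hρX : ∀ ω (t : ℝ≥0), (t : WithTop ℝ≥0) ≤ ρ ω → realFlowStop (𝖶[κ, c] ω) x t ≠ 0) :
    IsItoProcess (stoppedProcess 𝖷[κ, c, x] ρ)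
      (trunc ρ fun s ω ↦ 2 / stoppedProcess 𝖷[κ, c, x] ρ s ω - c)
      (trunc ρ fun _ _ ↦ -Real.sqrt κ) brownian brownianFiltration preWienerMeasure := by
  haveI := isProbabilityMeasure_preWienerMeasure'
  set X : ℝ≥0 → (ℝ≥0 → ℝ) → ℝ := 𝖷[κ, c, x] with hXdef
  set V := stoppedProcess X ρ with hVdef
  have hρ' : ∀ t : ℝ≥0, MeasurableSet[brownianFiltration t] {ω | ρ ω < t} :=
    fun t ↦ hρ.measurableSet_lt t
  -- the paths of `V` are continuous and never vanish
  have hVc : ∀ ω, Continuous fun s ↦ V s ω := fun ω ↦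
    continuous_stoppedProcess_apply (X := 𝖷[κ, c, x]) (continuous_sleDriftRealFlowStop hx ω) ρ
  have hVne : ∀ ω s, V s ω ≠ 0 := by
    intro ω s
    simp only [hVdef, stoppedProcess]
    exact hρX ω _ (coe_untopA_min_le s (ρ ω))
  refine ⟨ae_of_all _ fun ω t ↦ ?_, ?_⟩
  · -- the drift is locally integrable: `2/V - c` is continuous in time
    refine integrableOn_trunc ?_
    have hc : Continuous fun r : ℝ ↦ 2 / V r.toNNReal ω - c :=
      (continuous_const.div ((hVc ω).comp continuous_real_toNNReal) fun r ↦ hVne ω _).sub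
        continuous_const
    exact hc.continuousOn.integrableOn_compact isCompact_Icc
  · -- the Itô integral of the truncated constant, a square-integrable martingale
    have hσ : IsStronglyProgressive brownianFiltration
        (trunc ρ fun (_ : ℝ≥0) (_ : ℝ≥0 → ℝ) ↦ -Real.sqrt κ) :=
      isStronglyProgressive_trunc (isStronglyProgressive_const _ _) hρ'
    have hfin : ∀ t : ℝ≥0, ∫⁻ ω, (∫⁻ s in Set.Icc (0 : ℝ) t, ENNReal.ofReal
        ((trunc ρ (fun (_ : ℝ≥0) (_ : ℝ≥0 → ℝ) ↦ -Real.sqrt κ)) s.toNNReal ω ^ 2))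
        ∂preWienerMeasure ≠ ∞ := by
      intro t
      have hle : ∀ ω : ℝ≥0 → ℝ, (∫⁻ s in Set.Icc (0 : ℝ) t, ENNReal.ofReal
          ((trunc ρ (fun (_ : ℝ≥0) (_ : ℝ≥0 → ℝ) ↦ -Real.sqrt κ)) s.toNNReal ω ^ 2)) ≤
          ENNReal.ofReal κ * volume (Set.Icc (0 : ℝ) t) := by
        intro ω
        rw [← setLIntegral_const]
        refine lintegral_mono fun s ↦ ENNReal.ofReal_le_ofReal ?_
        rw [trunc_apply]
        split_ifs
        · rw [neg_sq, Real.sq_sqrt κ.coe_nonneg]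
        · simp
      refine ne_top_of_le_ne_top ?_ (lintegral_mono hle)
      rw [lintegral_const, measure_univ, mul_one, Real.volume_Icc, sub_zero]
      exact ENNReal.mul_ne_top ENNReal.ofReal_ne_top ENNReal.ofReal_ne_top
    obtain ⟨J, hJ, -, -⟩ := exists_isItoIntegral_of_sq_integrable hσ hfin
    have hJeq := IsItoIntegral.ae_eq_stoppedProcess martingale_brownian_holds
      martingale_brownian_sq_sub_holds memLp_two_brownian continuous_brownian
      (H := fun (_ : ℝ≥0) (_ : ℝ≥0 → ℝ) ↦ -Real.sqrt κ) measurable_const hρ'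
      (isItoIntegral_const_brownian (-Real.sqrt κ)) hJ
    refine ⟨J, hJ, ?_⟩
    filter_upwards [hJeq] with ω hω t
    have h0 : V 0 ω = x := by
      simp only [hVdef]
      rw [stoppedProcess_eq_of_le (coe_zero_le_withTop _)]
      exact sleDriftRealFlowStop_zero_apply hx ω
    rw [hω t, h0]
    exact stoppedProcess_sleDriftRealFlowStop_eq hx hρX ω t

/-! ### The drifted flow stopped at the exit time of `(x₁, x₂)` -/

variable {x₁ x₂ : ℝ}

/-- The exit time of the frozen drifted flow from `(x₁, x₂)` is a stopping time of the raw
Brownian filtration (`Process.isStoppingTime_exitTime`). [folklore] -/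
theorem isStoppingTime_exitTime_sleDriftRealFlowStop (κ : ℝ≥0) (c : ℝ) (hx : 0 < x) (x₁ x₂ : ℝ) :
    IsStoppingTime brownianFiltration (Process.exitTime 𝖷[κ, c, x] x₁ x₂) :=
  Process.isStoppingTime_exitTime (adapted_sleDriftRealFlowStop κ c hx)
    (continuous_sleDriftRealFlowStop hx.ne')

/-- The stopped frozen drifted flow is strongly progressive. [folklore] -/
theorem isStronglyProgressive_stoppedProcess_sleDriftRealFlowStop (κ : ℝ≥0) (c : ℝ) (hx : 0 < x)
    (x₁ x₂ : ℝ) :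
    IsStronglyProgressive brownianFiltration (stoppedProcess 𝖷[κ, c, x]
      (Process.exitTime 𝖷[κ, c, x] x₁ x₂)) :=
  StronglyAdapted.isStronglyProgressive_of_continuous
    (Process.stronglyAdapted_stoppedProcess_exitTime (adapted_sleDriftRealFlowStop κ c hx)
      (continuous_sleDriftRealFlowStop hx.ne'))
    fun ω ↦ Process.continuous_stoppedProcess_path (u := 𝖷[κ, c, x])
      (continuous_sleDriftRealFlowStop hx.ne' ω) _

/-- **The stopped drifted flow stays in `[x₁, x₂]`** when `x₁ < x < x₂` (every path). [folklore] -/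
theorem stoppedProcess_sleDriftRealFlowStop_mem_Icc (hx : 0 < x) (hx₁ : x₁ < x) (hx₂ : x < x₂)
    (t : ℝ≥0) (ω : ℝ≥0 → ℝ) :
    stoppedProcess 𝖷[κ, c, x]
      (Process.exitTime 𝖷[κ, c, x] x₁ x₂) t ω ∈ Icc x₁ x₂ :=
  Process.stoppedProcess_exitTime_mem_Icc (u := 𝖷[κ, c, x]) (continuous_sleDriftRealFlowStop hx.ne' ω)
    (show realFlowStop (𝖶[κ, c] ω) x 0 ∈ Ioo x₁ x₂ by
      rw [sleDriftRealFlowStop_zero_apply hx.ne']; exact ⟨hx₁, hx₂⟩) t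

/-- The frozen drifted flow does not vanish up to the exit time of `(x₁, x₂)`,
`0 < x₁ < x < x₂`. [folklore] -/
theorem sleDriftRealFlowStop_ne_zero_of_le_exitTime (hx₁ : 0 < x₁) (hx₁x : x₁ < x) (hxx₂ : x < x₂)
    (ω : ℝ≥0 → ℝ) (t : ℝ≥0)
    (ht : (t : WithTop ℝ≥0) ≤ Process.exitTime 𝖷[κ, c, x] x₁ x₂ ω) :
    realFlowStop (𝖶[κ, c] ω) x t ≠ 0 := by
  have hmem := stoppedProcess_sleDriftRealFlowStop_mem_Icc (κ := κ) (c := c) (hx₁.trans hx₁x)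
    hx₁x hxx₂ t ω
  rw [stoppedProcess_eq_of_le ht] at hmem
  exact (hx₁.trans_le hmem.1).ne'

/-- The stopped drifted flow at a fixed time is a measurable random variable (for the ambient
product σ-algebra). [folklore] -/
theorem measurable_stoppedProcess_sleDriftRealFlowStop (hx : 0 < x) (x₁ x₂ : ℝ) (t : ℝ≥0) :
    Measurable fun ω ↦ stoppedProcess 𝖷[κ, c, x]
      (Process.exitTime 𝖷[κ, c, x] x₁ x₂) t ω :=
  (((isStronglyProgressive_stoppedProcess_sleDriftRealFlowStop κ c hx x₁ x₂).stronglyAdapted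
    t).mono (brownianFiltration.le t)).measurable

/-! ### The generator inequality: `F(x) ≤ E[F(X_{t∧σ})]` when `L F ≥ 0` -/

/-- **Generator inequality for the drifted flow** (the Itô step of Lawler (2005), proof of
Prop. 1.21, run for `dX = (2/X - c) dt - √κ dB` and with an inequality). Let
`0 < x₁ < x < x₂`, `X` the frozen drifted flow from `x`, `σ` its exit time from `(x₁, x₂)`,
and `F ∈ C²(ℝ)` with `(2/u - c) F'(u) + (κ/2) F''(u) ≥ 0` on `[x₁, x₂]`. Then
`F(x) ≤ E[F(X_{t∧σ})]` for every `t`. Proof: by Itô's formula for the Itô process `X^σ`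
(`isItoProcess_stoppedProcess_sleDriftRealFlowStop`,
`Literature.Analysis.FunctionSpaces.ito_formula_itoProcess_ae_of`), a.s.
`F(X_{t∧σ}) = F(x) + ∫₀ᵗ 𝟙_{s≤σ} (L F)(X^σ_s) ds + K_t ≥ F(x) + K_t`, where
`K = ∫ 𝟙_{[0,σ]}(-√κ) F'(X^σ) dB` has a bounded progressive integrand and is therefore a
martingale with `K₀ = 0` (`Process.exists_isItoIntegral_of_sqErr_ne_top`), so `E[K_t] = 0`.
[cite: Lawler2005, §1.10 Prop. 1.21] -/
theorem le_integral_of_generator_nonneg (hx₁ : 0 < x₁) (hx₁x : x₁ < x) (hxx₂ : x < x₂)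
    {F : ℝ → ℝ} (hF : ContDiff ℝ 2 F)
    (hgen : ∀ u ∈ Icc x₁ x₂, 0 ≤ (2 / u - c) * deriv F u + (κ : ℝ) / 2 * iteratedDeriv 2 F u)
    (t : ℝ≥0) :
    F x ≤ ∫ ω, F (stoppedProcess 𝖷[κ, c, x]
      (Process.exitTime 𝖷[κ, c, x] x₁ x₂) t ω) ∂preWienerMeasure := by
  haveI := isProbabilityMeasure_preWienerMeasure'
  have hx : 0 < x := hx₁.trans hx₁x
  set X : ℝ≥0 → (ℝ≥0 → ℝ) → ℝ := 𝖷[κ, c, x] with hX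
  set σ := Process.exitTime X x₁ x₂ with hσ
  set Y := stoppedProcess X σ with hY
  set b : ℝ≥0 → (ℝ≥0 → ℝ) → ℝ := trunc σ fun s ω ↦ 2 / Y s ω - c with hb
  set σ' : ℝ≥0 → (ℝ≥0 → ℝ) → ℝ := trunc σ fun _ _ ↦ -Real.sqrt κ with hσ'
  have hσst : IsStoppingTime brownianFiltration σ :=
    isStoppingTime_exitTime_sleDriftRealFlowStop κ c hx x₁ x₂
  have hσopt : ∀ t : ℝ≥0, MeasurableSet[brownianFiltration t] {ω | σ ω < t} := fun t ↦
    hσst.measurableSet_lt t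
  have hYito : IsItoProcess Y b σ' brownian brownianFiltration preWienerMeasure :=
    isItoProcess_stoppedProcess_sleDriftRealFlowStop hx.ne' hσst
      (sleDriftRealFlowStop_ne_zero_of_le_exitTime hx₁ hx₁x hxx₂)
  have hYprog : IsStronglyProgressive brownianFiltration Y :=
    isStronglyProgressive_stoppedProcess_sleDriftRealFlowStop κ c hx x₁ x₂
  have hYadapt : Adapted brownianFiltration Y := hYprog.stronglyAdapted.adapted
  have hσ'prog : IsStronglyProgressive brownianFiltration σ' :=
    isStronglyProgressive_trunc (isStronglyProgressive_const _ _) hσopt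
  have hYmem : ∀ t ω, Y t ω ∈ Icc x₁ x₂ :=
    stoppedProcess_sleDriftRealFlowStop_mem_Icc hx hx₁x hxx₂
  have hY0 : ∀ ω, Y 0 ω = x := fun ω ↦ by
    have h1 : Y 0 ω = X 0 ω := by rw [hY, stoppedProcess, untopA_min_zero]
    rw [h1]
    exact sleDriftRealFlowStop_zero_apply hx.ne' ω
  -- the integrand `σ' F'(Y)` of the stochastic integral is progressive and bounded
  have hF' : Continuous (deriv F) := hF.continuous_deriv (by norm_num)
  obtain ⟨C, hC⟩ := (isCompact_Icc (a := x₁) (b := x₂)).exists_bound_of_continuousOn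
    hF'.continuousOn
  set H : ℝ≥0 → (ℝ≥0 → ℝ) → ℝ := fun t ω ↦ σ' t ω * deriv F (Y t ω) with hH
  have hHprog : IsStronglyProgressive brownianFiltration H :=
    hσ'prog.mul (Literature.Analysis.FunctionSpaces.IsStronglyProgressive.comp_measurable₂ hYprog
      (F := fun _ u ↦ deriv F u) (hF'.measurable.comp measurable_snd))
  have hHbound : ∀ t ω, |H t ω| ≤ Real.sqrt κ * C := by
    intro t ω
    simp only [hH, abs_mul]
    refine mul_le_mul (abs_trunc_neg_sqrt_le κ σ t ω) ?_ (abs_nonneg _) (Real.sqrt_nonneg _)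
    simpa only [Real.norm_eq_abs] using hC _ (hYmem t ω)
  obtain ⟨K, hK, hKmart, -⟩ := exists_isItoIntegral_of_sqErr_ne_top
    martingale_brownian_holds martingale_brownian_sq_sub_holds memLp_two_brownian
    continuous_brownian hHprog (sqErr_zero_ne_top_of_abs_le hHbound)
  -- Itô's formula for `f(t, u) = F(u)` along `Y`
  have hf : ContDiff ℝ 2 (Function.uncurry fun (_ : ℝ) (u : ℝ) ↦ F u) := hF.comp contDiff_snd
  have hito : ∀ᵐ ω ∂preWienerMeasure, ∀ t : ℝ≥0,
      F (Y t ω) = F (Y 0 ω) +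
        (∫ s in (0 : ℝ)..t, (deriv (fun _ : ℝ ↦ F (Y s.toNNReal ω)) (s.toNNReal : ℝ) +
          b s.toNNReal ω * deriv F (Y s.toNNReal ω) +
          2⁻¹ * σ' s.toNNReal ω ^ 2 * iteratedDeriv 2 F (Y s.toNNReal ω))) + K t ω :=
    ito_formula_itoProcess_ae_of (f := fun _ u ↦ F u) hf hYadapt hσ'prog hYito hK
  -- the drift of `F(Y)` is `𝟙_{[0,σ]} (L F)(Y) ≥ 0`
  have hintegrand : ∀ ω (s : ℝ), 0 ≤ deriv (fun _ : ℝ ↦ F (Y s.toNNReal ω)) (s.toNNReal : ℝ) +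
      b s.toNNReal ω * deriv F (Y s.toNNReal ω) +
      2⁻¹ * σ' s.toNNReal ω ^ 2 * iteratedDeriv 2 F (Y s.toNNReal ω) := by
    intro ω s
    rw [deriv_const, zero_add, hb, trunc_apply, hσ', trunc_apply]
    split_ifs with h
    · have hg := hgen _ (hYmem s.toNNReal ω)
      rw [neg_sq, Real.sq_sqrt κ.coe_nonneg]
      linarith
    · simp
  have hpath : ∀ᵐ ω ∂preWienerMeasure, F x + K t ω ≤ F (Y t ω) := by
    filter_upwards [hito] with ω hω
    have hnn : 0 ≤ ∫ s in (0 : ℝ)..t, (deriv (fun _ : ℝ ↦ F (Y s.toNNReal ω)) (s.toNNReal : ℝ) +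
        b s.toNNReal ω * deriv F (Y s.toNNReal ω) +
        2⁻¹ * σ' s.toNNReal ω ^ 2 * iteratedDeriv 2 F (Y s.toNNReal ω)) :=
      intervalIntegral.integral_nonneg (NNReal.coe_nonneg t) fun s _ ↦ hintegrand ω s
    rw [hω t, hY0 ω]
    linarith
  -- integrate: `E[K_t] = E[K_0] = 0`
  obtain ⟨C₀, hC₀⟩ := (isCompact_Icc (a := x₁) (b := x₂)).exists_bound_of_continuousOn
    hF.continuous.continuousOn
  have hFYint : Integrable (fun ω ↦ F (Y t ω)) preWienerMeasure := by
    refine Integrable.of_bound ?_ C₀ (ae_of_all _ fun ω ↦ hC₀ _ (hYmem t ω))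
    exact (hF.continuous.measurable.comp
      (measurable_stoppedProcess_sleDriftRealFlowStop hx x₁ x₂ t)).aestronglyMeasurable
  have hKint : Integrable (K t) preWienerMeasure := hKmart.integrable t
  have hK0 : ∫ ω, K t ω ∂preWienerMeasure = 0 := by
    rw [integral_eq_of_martingale hKmart t]
    simp [hK.apply_zero]
  calc F x = ∫ ω, (F x + K t ω) ∂preWienerMeasure := by
        rw [integral_add (integrable_const _) hKint, integral_const, smul_eq_mul, probReal_univ,
          one_mul, hK0, add_zero]
    _ ≤ ∫ ω, F (Y t ω) ∂preWienerMeasure :=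
        integral_mono_ae ((integrable_const _).add hKint) hFYint hpath

/-! ### The Lyapunov function `Φ(u) = log u + (κ/4) e^{2cu/κ}` of the drifted generator -/

/-- `Φ'(u) = 1/u + (κ/4) e^{2cu/κ} (2c/κ)` for `u ≠ 0`. [folklore] -/
theorem hasDerivAt_driftLyapunov (κ c : ℝ) {u : ℝ} (hu : u ≠ 0) :
    HasDerivAt (fun v ↦ Φ⟪κ, c⟫ v) (u⁻¹ + κ / 4 * (Real.exp (2 * c / κ * u) * (2 * c / κ))) u := by
  have h : HasDerivAt (fun v : ℝ ↦ κ / 4 * Real.exp (2 * c / κ * v))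
      (κ / 4 * (Real.exp (2 * c / κ * u) * (2 * c / κ))) u :=
    ((hasDerivAt_const_mul (x := u) (2 * c / κ)).exp).const_mul (κ / 4)
  exact (Real.hasDerivAt_log hu).add h

/-- The derivative of `Φ` off `0`. [folklore] -/
theorem deriv_driftLyapunov (κ c : ℝ) {u : ℝ} (hu : u ≠ 0) :
    deriv (fun v ↦ Φ⟪κ, c⟫ v) u = u⁻¹ + κ / 4 * (Real.exp (2 * c / κ * u) * (2 * c / κ)) :=
  (hasDerivAt_driftLyapunov κ c hu).deriv

/-- Near a point `u ≠ 0` the derivative of `Φ` is the smooth function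
`v ↦ 1/v + (κ/4) e^{2cv/κ} (2c/κ)`. [folklore] -/
theorem deriv_driftLyapunov_eventuallyEq (κ c : ℝ) {u : ℝ} (hu : u ≠ 0) :
    deriv (fun v ↦ Φ⟪κ, c⟫ v) =ᶠ[𝓝 u]
      fun v ↦ v⁻¹ + κ / 4 * (Real.exp (2 * c / κ * v) * (2 * c / κ)) := by
  filter_upwards [isOpen_ne.mem_nhds hu] with v hv
  exact deriv_driftLyapunov κ c hv

/-- `Φ''(u) = -1/u² + (κ/4) e^{2cu/κ} (2c/κ)²` for `u ≠ 0`. [folklore] -/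
theorem iteratedDeriv_two_driftLyapunov (κ c : ℝ) {u : ℝ} (hu : u ≠ 0) :
    iteratedDeriv 2 (fun v ↦ Φ⟪κ, c⟫ v) u =
      -(u ^ 2)⁻¹ + κ / 4 * (Real.exp (2 * c / κ * u) * (2 * c / κ) * (2 * c / κ)) := by
  rw [iteratedDeriv_succ, iteratedDeriv_one, (deriv_driftLyapunov_eventuallyEq κ c hu).deriv_eq]
  have h : HasDerivAt (fun v : ℝ ↦ κ / 4 * (Real.exp (2 * c / κ * v) * (2 * c / κ)))
      (κ / 4 * (Real.exp (2 * c / κ * u) * (2 * c / κ) * (2 * c / κ))) u :=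
    (((hasDerivAt_const_mul (x := u) (2 * c / κ)).exp).mul_const (2 * c / κ)).const_mul (κ / 4)
  exact ((hasDerivAt_inv hu).add h).deriv

/-- `Φ` is smooth off `0`. [folklore] -/
theorem contDiffAt_driftLyapunov (κ c : ℝ) {n : WithTop ℕ∞} {u : ℝ} (hu : u ≠ 0) :
    ContDiffAt ℝ n (fun v ↦ Φ⟪κ, c⟫ v) u := by
  have h1 : ContDiff ℝ n fun v : ℝ ↦ κ / 4 * Real.exp (2 * c / κ * v) :=
    contDiff_const.mul (Real.contDiff_exp.comp (contDiff_const.mul contDiff_id))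
  exact (Real.contDiffAt_log.2 hu).add h1.contDiffAt

/-- `Φ` is Borel measurable. [folklore] -/
theorem measurable_driftLyapunov (κ c : ℝ) : Measurable fun v ↦ Φ⟪κ, c⟫ v := by
  have h1 : Measurable fun v : ℝ ↦ κ / 4 * Real.exp (2 * c / κ * v) :=
    measurable_const.mul (Real.measurable_exp.comp (measurable_const.mul measurable_id))
  exact Real.measurable_log.add h1

/-- **The sign lemma**: `c (e^{2cu/κ} - 1) ≥ 0` for `κ > 0`, `u > 0` and every real `c` (both
factors have the sign of `c`). [folklore] -/
theorem mul_exp_sub_one_nonneg {κ : ℝ} (hκ : 0 < κ) (c : ℝ) {u : ℝ} (hu : 0 < u) :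
    0 ≤ c * (Real.exp (2 * c / κ * u) - 1) := by
  rcases le_total 0 c with hc | hc
  · have harg : 0 ≤ 2 * c / κ * u := mul_nonneg (div_nonneg (by linarith) hκ.le) hu.le
    exact mul_nonneg hc (sub_nonneg.2 (Real.one_le_exp harg))
  · have harg : 2 * c / κ * u ≤ 0 := by
      rw [show 2 * c / κ * u = c * (2 * u / κ) by ring]
      exact mul_nonpos_iff.2 (Or.inr ⟨hc, by positivity⟩)
    have hE : Real.exp (2 * c / κ * u) - 1 ≤ 0 := sub_nonpos.2 (Real.exp_le_one_iff.2 harg)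
    nlinarith

/-- **`L Φ ≥ 0`**: for `0 < κ ≤ 4`, every real `c` and `u > 0`,
`(2/u - c) Φ'(u) + (κ/2) Φ''(u) = (2 - κ/2)/u² + (c/u)(e^{2cu/κ} - 1) ≥ 0`.
[cite: Lawler2005, §1.10 Prop. 1.21] -/
theorem generator_driftLyapunov_nonneg {κ : ℝ} (hκ0 : 0 < κ) (hκ4 : κ ≤ 4) (c : ℝ) {u : ℝ}
    (hu : 0 < u) :
    0 ≤ (2 / u - c) * deriv (fun v ↦ Φ⟪κ, c⟫ v) u +
      κ / 2 * iteratedDeriv 2 (fun v ↦ Φ⟪κ, c⟫ v) u := by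
  rw [deriv_driftLyapunov κ c hu.ne', iteratedDeriv_two_driftLyapunov κ c hu.ne']
  have hsign := mul_exp_sub_one_nonneg hκ0 c hu
  set E := Real.exp (2 * c / κ * u) with hE
  have hu' : u ≠ 0 := hu.ne'
  have hκ' : κ ≠ 0 := hκ0.ne'
  have key : (2 / u - c) * (u⁻¹ + κ / 4 * (E * (2 * c / κ))) +
      κ / 2 * (-(u ^ 2)⁻¹ + κ / 4 * (E * (2 * c / κ) * (2 * c / κ))) =
      (2 - κ / 2) / u ^ 2 + c * (E - 1) / u := by
    field_simp
    ring
  rw [key]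
  exact add_nonneg (div_nonneg (by linarith) (sq_nonneg u)) (div_nonneg hsign hu.le)

/-- `Φ(u) ≤ log x₂ + (κ/4) e^{|2c/κ| x₂}` for `0 < u ≤ x₂` (`κ ≥ 0`). [folklore] -/
theorem driftLyapunov_le_bound {κ : ℝ} (hκ : 0 ≤ κ) (c : ℝ) {u x₂ : ℝ} (hu : 0 < u)
    (hux₂ : u ≤ x₂) : Φ⟪κ, c⟫ u ≤ 𝔅⟪κ, c⟫ x₂ := by
  have h1 : Real.log u ≤ Real.log x₂ := Real.log_le_log hu hux₂
  have h2 : Real.exp (2 * c / κ * u) ≤ Real.exp (|2 * c / κ| * x₂) := by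
    refine Real.exp_le_exp.2 ?_
    calc 2 * c / κ * u ≤ |2 * c / κ * u| := le_abs_self _
      _ = |2 * c / κ| * u := by rw [abs_mul, abs_of_pos hu]
      _ ≤ |2 * c / κ| * x₂ := mul_le_mul_of_nonneg_left hux₂ (abs_nonneg _)
  have h3 := mul_le_mul_of_nonneg_left h2 (div_nonneg hκ (by norm_num : (0 : ℝ) ≤ 4))
  linarith

/-- `Φ(x₁) < log x₂ + (κ/4) e^{|2c/κ| x₂}` for `0 < x₁ < x₂` (`κ ≥ 0`). [folklore] -/
theorem driftLyapunov_lt_bound {κ : ℝ} (hκ : 0 ≤ κ) (c : ℝ) {x₁ x₂ : ℝ} (hx₁ : 0 < x₁)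
    (hx₁₂ : x₁ < x₂) : Φ⟪κ, c⟫ x₁ < 𝔅⟪κ, c⟫ x₂ := by
  have h1 : Real.log x₁ < Real.log x₂ := Real.log_lt_log hx₁ hx₁₂
  have h2 : Real.exp (2 * c / κ * x₁) ≤ Real.exp (|2 * c / κ| * x₂) := by
    refine Real.exp_le_exp.2 ?_
    calc 2 * c / κ * x₁ ≤ |2 * c / κ * x₁| := le_abs_self _
      _ = |2 * c / κ| * x₁ := by rw [abs_mul, abs_of_pos hx₁]
      _ ≤ |2 * c / κ| * x₂ := mul_le_mul_of_nonneg_left hx₁₂.le (abs_nonneg _)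
  have h3 := mul_le_mul_of_nonneg_left h2 (div_nonneg hκ (by norm_num : (0 : ℝ) ≤ 4))
  linarith

/-- `log x₁ ≤ Φ(u)` for `0 < x₁ ≤ u` (`κ ≥ 0`; the exponential term is nonnegative). [folklore] -/
theorem log_le_driftLyapunov {κ : ℝ} (hκ : 0 ≤ κ) (c : ℝ) {x₁ u : ℝ} (hx₁ : 0 < x₁)
    (hx₁u : x₁ ≤ u) : Real.log x₁ ≤ Φ⟪κ, c⟫ u := by
  have h1 : Real.log x₁ ≤ Real.log u := Real.log_le_log hx₁ hx₁u
  have h2 : 0 ≤ κ / 4 * Real.exp (2 * c / κ * u) :=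
    mul_nonneg (div_nonneg hκ (by norm_num)) (Real.exp_pos _).le
  linarith

/-- **`Φ(0+) = -∞`**: `log u → -∞` while the exponential term converges. [folklore] -/
theorem tendsto_driftLyapunov_atBot (κ c : ℝ) :
    Tendsto (fun v ↦ Φ⟪κ, c⟫ v) (𝓝[>] 0) atBot := by
  have hcont : Continuous fun u : ℝ ↦ κ / 4 * Real.exp (2 * c / κ * u) := by fun_prop
  have h2 : Tendsto (fun u : ℝ ↦ κ / 4 * Real.exp (2 * c / κ * u)) (𝓝[>] 0)
      (𝓝 (κ / 4 * Real.exp (2 * c / κ * 0))) :=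
    (hcont.tendsto 0).mono_left nhdsWithin_le_nhds
  exact Real.tendsto_log_nhdsGT_zero.atBot_add h2

/-! ### Optional stopping as a Markov inequality -/

/-- Lawler's exit time of the frozen drifted flow from `(x₁, x₂)` (minimum of the first hitting
times of `{re ≤ x₁}` and `{x₂ ≤ re}`, `Loewner.exitTime`) is the exit time
`Literature.Probability.Process.exitTime` of the process `𝖷[κ, c, x]`
(cf. `sleExitTime_eq_exitTime` for `c = 0`). [folklore] -/
theorem exitTime_sleDriftDriving_eq (κ : ℝ≥0) (c x x₁ x₂ : ℝ) (ω : ℝ≥0 → ℝ) :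
    Loewner.exitTime (𝖶[κ, c] ω) x x₁ x₂ =
      Process.exitTime 𝖷[κ, c, x] x₁ x₂ ω := by
  simp only [Loewner.exitTime, Loewner.lowerTime, Loewner.levelTime]
  rw [← firstHit_union]
  have hset : ({z : ℂ | z.re ≤ x₁} ∪ {z | x₂ ≤ z.re}) = {z | z.re ∈ (Set.Ioo x₁ x₂)ᶜ} := by
    ext z
    simp only [Set.mem_union, Set.mem_setOf_eq, Set.mem_compl_iff, Set.mem_Ioo, not_and_or, not_lt]
  rw [hset]
  exact firstHit_ofReal_setOf_re_mem 𝖷[κ, c, x] _ ω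

/-- **Swallowed paths exit at the lower level** (drifted form of Lawler (2005), proof of
Prop. 1.21): on `{T_x ≤ t} ∩ {t < levelTime x₂}` the drifted flow stopped at the exit time of
`(x₁, x₂)` equals `x₁` at time `t` (`0 ≤ x₁ < x`; pathwise,
`Loewner.realFlowStop_untopA_eq_of_swallowingTime_le`). [cite: Lawler2005, §1.10 Prop. 1.21] -/
theorem stoppedProcess_sleDriftRealFlowStop_eq_of_swallowingTime_le (hx : 0 < x) (hx₁0 : 0 ≤ x₁)
    (hx₁ : x₁ < x) {t : ℝ≥0} {ω : ℝ≥0 → ℝ} (hT : swallowingTime (𝖶[κ, c] ω) x ≤ t)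
    (hlev : (t : WithTop ℝ≥0) < levelTime (𝖶[κ, c] ω) x x₂) :
    stoppedProcess 𝖷[κ, c, x]
      (Process.exitTime 𝖷[κ, c, x] x₁ x₂) t ω = x₁ := by
  rw [stoppedProcess, ← exitTime_sleDriftDriving_eq]
  exact realFlowStop_untopA_eq_of_swallowingTime_le (continuous_sleDriftDriving κ c ω)
    (by simpa using hx) hx₁0 (by simpa using hx₁) hT hlev

/-- **`P{X_{t∧σ} = x₁} ≤ (M - Φ(x)) / (M - Φ(x₁))`** for the drifted flow, `0 < κ ≤ 4`,
`0 < x₁ < x < x₂`, `M = log x₂ + (κ/4)e^{|2c/κ|x₂}` (Lawler (2005), proof of Prop. 1.21,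
one-sided, at finite time and with the Lyapunov function `Φ` in place of the scale function):
`E[Φ(X_{t∧σ})] ≥ Φ(x)` by the generator inequality (`le_integral_of_generator_nonneg` for a `C²`
extension of `Φ` off `[x₁, x₂]`, `generator_driftLyapunov_nonneg`), and `M - Φ(X_{t∧σ}) ≥ 0`
equals `M - Φ(x₁)` on `{X_{t∧σ} = x₁}`; Markov's inequality. [cite: Lawler2005, §1.10 Prop. 1.21] -/
theorem measureReal_stoppedProcess_sleDriftRealFlowStop_eq_le {κ : ℝ≥0} (hκ0 : 0 < κ) (hκ : κ ≤ 4)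
    (c : ℝ) (hx₁ : 0 < x₁) (hx₁x : x₁ < x) (hx₂ : x < x₂) (t : ℝ≥0) :
    preWienerMeasure.real {ω | stoppedProcess 𝖷[κ, c, x]
        (Process.exitTime 𝖷[κ, c, x] x₁ x₂) t ω = x₁} ≤
      (𝔅⟪(κ : ℝ), c⟫ x₂ - Φ⟪(κ : ℝ), c⟫ x) / (𝔅⟪(κ : ℝ), c⟫ x₂ - Φ⟪(κ : ℝ), c⟫ x₁) := by
  haveI := isProbabilityMeasure_preWienerMeasure'
  have hx : 0 < x := hx₁.trans hx₁x
  have hκ0' : (0 : ℝ) < κ := by exact_mod_cast hκ0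
  have hκ4 : (κ : ℝ) ≤ 4 := by exact_mod_cast hκ
  set Φ : ℝ → ℝ := fun v ↦ Φ⟪(κ : ℝ), c⟫ v with hΦ
  set M : ℝ := 𝔅⟪(κ : ℝ), c⟫ x₂ with hM
  -- a `C²` extension of `Φ` off `[x₁, x₂]` and the generator inequality
  obtain ⟨F, hF, hFg⟩ := exists_contDiff_eventuallyEq_of_pos (n := 2) (g := Φ) hx₁
    (hx₁x.trans hx₂).le fun u hu ↦ contDiffAt_driftLyapunov _ c hu.ne'
  have hgen : ∀ u ∈ Icc x₁ x₂,
      0 ≤ (2 / u - c) * deriv F u + (κ : ℝ) / 2 * iteratedDeriv 2 F u := by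
    intro u hu
    rw [(hFg u hu).deriv_eq, (hFg u hu).iteratedDeriv_eq 2]
    exact generator_driftLyapunov_nonneg hκ0' hκ4 c (hx₁.trans_le hu.1)
  have hle := le_integral_of_generator_nonneg (κ := κ) (c := c) hx₁ hx₁x hx₂ hF hgen t
  set V := stoppedProcess 𝖷[κ, c, x] (Process.exitTime 𝖷[κ, c, x] x₁ x₂) t with hV
  have hVmem : ∀ ω, V ω ∈ Icc x₁ x₂ := fun ω ↦
    stoppedProcess_sleDriftRealFlowStop_mem_Icc hx hx₁x hx₂ t ω
  have hVpos : ∀ ω, 0 < V ω := fun ω ↦ hx₁.trans_le (hVmem ω).1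
  have hVmeas : Measurable V := measurable_stoppedProcess_sleDriftRealFlowStop hx x₁ x₂ t
  -- `Φ(x) ≤ E[Φ(V)]`
  have hFx : F x = Φ x := (hFg x ⟨hx₁x.le, hx₂.le⟩).eq_of_nhds
  have hle' : Φ x ≤ ∫ ω, Φ (V ω) ∂preWienerMeasure := by
    have h2 : ∫ ω, F (V ω) ∂preWienerMeasure = ∫ ω, Φ (V ω) ∂preWienerMeasure :=
      integral_congr_ae (ae_of_all _ fun ω ↦ (hFg _ (hVmem ω)).eq_of_nhds)
    rw [← hFx, ← h2]
    exact hle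
  -- integrability and the bounds `log x₁ ≤ Φ(V) ≤ M`
  have hΦV_le : ∀ ω, Φ (V ω) ≤ M := fun ω ↦
    driftLyapunov_le_bound hκ0'.le c (hVpos ω) (hVmem ω).2
  have hΦV_ge : ∀ ω, Real.log x₁ ≤ Φ (V ω) := fun ω ↦
    log_le_driftLyapunov hκ0'.le c hx₁ (hVmem ω).1
  have hΦVint : Integrable (fun ω ↦ Φ (V ω)) preWienerMeasure :=
    Integrable.of_mem_Icc (Real.log x₁) M
      ((measurable_driftLyapunov _ c).comp hVmeas).aemeasurable
      (ae_of_all _ fun ω ↦ ⟨hΦV_ge ω, hΦV_le ω⟩)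
  set f : (ℝ≥0 → ℝ) → ℝ := fun ω ↦ M - Φ (V ω) with hfdef
  have hfnonneg : 0 ≤ᵐ[preWienerMeasure] f := ae_of_all _ fun ω ↦ sub_nonneg.2 (hΦV_le ω)
  have hfint : Integrable f preWienerMeasure := (integrable_const M).sub hΦVint
  have hint : ∫ ω, f ω ∂preWienerMeasure ≤ M - Φ x := by
    rw [hfdef, integral_sub (integrable_const M) hΦVint, integral_const, smul_eq_mul,
      probReal_univ, one_mul]
    linarith
  have hε : 0 < M - Φ x₁ := sub_pos.2 (driftLyapunov_lt_bound hκ0'.le c hx₁ (hx₁x.trans hx₂))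
  have hmarkov := mul_meas_ge_le_integral_of_nonneg hfnonneg hfint (M - Φ x₁)
  have hsub : {ω | V ω = x₁} ⊆ {ω | M - Φ x₁ ≤ f ω} := by
    intro ω hω
    rw [mem_setOf_eq] at hω
    show M - Φ x₁ ≤ M - Φ (V ω)
    rw [hω]
  calc preWienerMeasure.real {ω | V ω = x₁}
      ≤ preWienerMeasure.real {ω | M - Φ x₁ ≤ f ω} := measureReal_mono hsub
    _ ≤ (M - Φ x) / (M - Φ x₁) := by
        rw [le_div_iff₀ hε, mul_comm]
        exact hmarkov.trans hint

/-! ### `x₁ → 0+`, then `T_x = ∞` almost surely, then all points at once -/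

/-- **The swallowing event sliced by a level is null** for the drifted chain (`0 < κ ≤ 4`,
`0 < x < x₂`): `P{T_x ≤ t, level x₂ not reached by time t} = 0`. The event is contained in
`{X_{t∧σ(x₁,x₂)} = x₁}` for every `x₁ ∈ (0, x)`, of probability at most
`(M - Φ(x))/(M - Φ(x₁)) → 0` as `x₁ → 0+` (`Φ(0+) = -∞`). [cite: Lawler2005, §1.10 Prop. 1.21] -/
theorem measure_drift_swallowingTime_le_inter_lt_levelTime_eq_zero {κ : ℝ≥0} (hκ0 : 0 < κ)
    (hκ : κ ≤ 4) (c : ℝ) (hx : 0 < x) (hx₂ : x < x₂) (t : ℝ≥0) :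
    preWienerMeasure {ω | swallowingTime (𝖶[κ, c] ω) x ≤ t ∧
      (t : WithTop ℝ≥0) < levelTime (𝖶[κ, c] ω) x x₂} = 0 := by
  haveI := isProbabilityMeasure_preWienerMeasure'
  set S : Set (ℝ≥0 → ℝ) := {ω | swallowingTime (𝖶[κ, c] ω) x ≤ t ∧
    (t : WithTop ℝ≥0) < levelTime (𝖶[κ, c] ω) x x₂} with hSdef
  set Φ : ℝ → ℝ := fun v ↦ Φ⟪(κ : ℝ), c⟫ v with hΦ
  set M : ℝ := 𝔅⟪(κ : ℝ), c⟫ x₂ with hM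
  have hle : ∀ x₁ ∈ Ioo 0 x, preWienerMeasure.real S ≤ (M - Φ x) / (M - Φ x₁) := by
    intro x₁ hx₁
    have hsub : S ⊆ {ω | stoppedProcess 𝖷[κ, c, x]
        (Process.exitTime 𝖷[κ, c, x] x₁ x₂) t ω = x₁} := fun ω hω ↦
      stoppedProcess_sleDriftRealFlowStop_eq_of_swallowingTime_le hx hx₁.1.le hx₁.2 hω.1 hω.2
    exact (measureReal_mono hsub).trans
      (measureReal_stoppedProcess_sleDriftRealFlowStop_eq_le hκ0 hκ c hx₁.1 hx₁.2 hx₂ t)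
  -- the bound tends to `0` as `x₁ → 0+`
  have htend : Tendsto (fun x₁ ↦ (M - Φ x) / (M - Φ x₁)) (𝓝[>] 0) (𝓝 0) := by
    have h1 : Tendsto (fun x₁ ↦ M - Φ x₁) (𝓝[>] 0) atTop := by
      have h := tendsto_neg_atBot_atTop.comp (tendsto_driftLyapunov_atBot (κ : ℝ) c)
      exact (tendsto_atTop_add_const_left _ M h).congr fun x₁ ↦ by
        rw [Function.comp_apply, sub_eq_add_neg]
    exact tendsto_const_nhds.div_atTop h1
  have hev : ∀ᶠ x₁ in 𝓝[>] (0 : ℝ), preWienerMeasure.real S ≤ (M - Φ x) / (M - Φ x₁) := by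
    filter_upwards [Ioo_mem_nhdsGT hx] with x₁ hx₁ using hle x₁ hx₁
  have h0 : preWienerMeasure.real S ≤ 0 := ge_of_tendsto htend hev
  have h0' : preWienerMeasure.real S = 0 := le_antisymm h0 measureReal_nonneg
  exact (measureReal_eq_zero_iff (measure_ne_top _ _)).1 h0'

/-- **No swallowing for the drifted chain, one point** (`0 < κ ≤ 4`, any real `c`, `x > 0`):
almost surely `T_x = ∞` under the driving function `√κ B + c·`. From the sliced null events:
`{T_x ≤ t} ⊆ ⋃ₙ {T_x ≤ t, level n + x + 1 not reached by time t}` (every path is bounded on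
`[0, t]`, `Loewner.exists_nat_lt_levelTime`) and `{T_x < ∞} = ⋃ₙ {T_x ≤ n}`.
[cite: LawlerSchrammWerner2003Restriction, proof of Lemma 8.3 (p. 36)] -/
theorem ae_drift_swallowingTime_eq_top {κ : ℝ≥0} (hκ0 : 0 < κ) (hκ : κ ≤ 4) (c : ℝ) (hx : 0 < x) :
    ∀ᵐ ω ∂preWienerMeasure, swallowingTime (𝖶[κ, c] ω) x = ⊤ := by
  -- `P{T_x ≤ t} = 0` for every `t`
  have ht : ∀ t : ℝ≥0,
      preWienerMeasure {ω | swallowingTime (𝖶[κ, c] ω) x ≤ t} = 0 := by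
    intro t
    have hsub : {ω : ℝ≥0 → ℝ | swallowingTime (𝖶[κ, c] ω) x ≤ t} ⊆
        ⋃ n : ℕ, {ω | swallowingTime (𝖶[κ, c] ω) x ≤ t ∧
          (t : WithTop ℝ≥0) < levelTime (𝖶[κ, c] ω) x ((n : ℝ) + x + 1)} := by
      intro ω hω
      obtain ⟨n, -, hn⟩ := exists_nat_lt_levelTime (continuous_sleDriftDriving κ c ω)
        (x := x) (by simpa using hx) t
      have hmono : levelTime (𝖶[κ, c] ω) x (n : ℝ) ≤
          levelTime (𝖶[κ, c] ω) x ((n : ℝ) + x + 1) := by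
        refine firstHit_mono _ fun z hz ↦ ?_
        simp only [mem_setOf_eq] at hz ⊢
        linarith
      exact mem_iUnion.2 ⟨n, hω, lt_of_lt_of_le hn hmono⟩
    refine measure_mono_null hsub (measure_iUnion_null fun n ↦ ?_)
    exact measure_drift_swallowingTime_le_inter_lt_levelTime_eq_zero hκ0 hκ c hx
      (by linarith [n.cast_nonneg (α := ℝ)]) t
  rw [ae_iff]
  have hsub : {ω : ℝ≥0 → ℝ | ¬ swallowingTime (𝖶[κ, c] ω) x = ⊤} ⊆
      ⋃ n : ℕ, {ω | swallowingTime (𝖶[κ, c] ω) x ≤ (n : ℝ≥0)} := by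
    intro ω hω
    obtain ⟨s, hs⟩ := WithTop.ne_top_iff_exists.1 hω
    obtain ⟨n, hn⟩ := exists_nat_ge s
    refine mem_iUnion.2 ⟨n, ?_⟩
    simp only [mem_setOf_eq]
    rw [← hs]
    exact_mod_cast hn
  exact measure_mono_null hsub (measure_iUnion_null fun n ↦ ht n)

end Drifted

/-! ### Discharge of the named fact -/

/-- **The named fact `sle_drift_swallowingTime_ofReal_eq_top` holds** ([LSW] proof of
Lemma 8.3, p. 36: under the driving function `√κ Bₜ + c t`, `κ ≤ 4`, "`x̃ₜ` never hits `0` and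
`τ₁ = ∞`"): for `0 < κ ≤ 4` and every real `c`, almost surely every real `x > 0` has swallowing
time `⊤` under `t ↦ √κ Bₜ + c t`. Per point this is `ae_drift_swallowingTime_eq_top` (optional
stopping with the Lyapunov function `Φ`); all points at once by monotonicity of `T_x` in `x`
along the levels `1/(n+1)` (`Loewner.forall_swallowingTime_eq_top_of_seq`).
[cite: LawlerSchrammWerner2003Restriction, proof of Lemma 8.3 (p. 36)] -/
theorem sle_drift_swallowingTime_ofReal_eq_top_holds : sle_drift_swallowingTime_ofReal_eq_top := by
  intro κ hκ0 hκ c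
  have hseq : ∀ᵐ ω ∂Process.preWienerMeasure, ∀ n : ℕ,
      Loewner.swallowingTime (𝖶[κ, c] ω) ((1 / ((n : ℝ) + 1) : ℝ) : ℂ) = ⊤ :=
    ae_all_iff.2 fun n ↦ ae_drift_swallowingTime_eq_top hκ0 hκ c (by positivity)
  filter_upwards [hseq] with ω hω x hx
  exact Loewner.forall_swallowingTime_eq_top_of_seq (continuous_sleDriftDriving κ c ω)
    (sleDriving_add_mul_zero κ c ω) hω hx

end Literature.Probability.RandomPlanarGeometry
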